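import Mathlib
import Literature.Computability.AlgebraicComplexity.PermanentIrreducible
import Summits.ValiantsHypothesis.ValiantsHypothesis.Theses.RefutationDegree
import Summits.ValiantsHypothesis.ValiantsHypothesis.Theorems.RefutationDegreeSmallCaseThreeFiveStubDefectCoeff
import Summits.ValiantsHypothesis.ValiantsHypothesis.Theorems.RefutationDegreeSmallCaseThreeFiveStubCoefIsHomogeneous
import Summits.ValiantsHypothesis.ValiantsHypothesis.Theorems.RefutationDegreeSmallCaseThreeFiveStubHomogeneousComponentMul
import Summits.ValiantsHypothesis.ValiantsHypothesis.Theorems.RefutationDegreeSmallCaseThreeFiveStubMapMatrixPencil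
import Summits.ValiantsHypothesis.ValiantsHypothesis.Theorems.RefutationDegreeSmallCaseThreeFiveStubMapDetPencil
import Summits.ValiantsHypothesis.ValiantsHypothesis.Theorems.RefutationDegreeSmallCaseThreeFiveStubBinomialEleven
import Summits.ValiantsHypothesis.ValiantsHypothesis.Theorems.RefutationDegreeSmallCaseThreeFiveStubUnivNilpOfSmallCaseThreeFive

/-!
# `SmallCaseThreeFive` (stmt-ValiantsHypothesis-5644), line `Sketch` — transfer layer

The crux asks for a Nullstellensatz refutation of Rep(3,5) (the system "`per₃(x) = det(A₀ + Σ_e x_e A_e)`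
identically in `x`", `A_i ∈ ℂ^{5×5}`, 250 unknowns) with every product of degree `≤ 55`.

This file reduces the crux to a purely algebraic NILPOTENCY statement:

* `coef μ` = the coefficient of `x^μ` in `det(A₀ + Σ x_e A_e)` (a quintic form in the 250 unknowns),
  `J` = the HOMOGENEOUS ideal generated by `coef μ` (`μ` not a permutation pattern) and the differences
  `coef μ_ρ - coef μ_id`;
* `smallCaseThreeFive_of_pow_mem` : `coef μ_id ^ 11 ∈ J → SmallCaseThreeFive` (homogeneous → inhomogeneous:
  `coef μ_id = 1 + eq_id`, `(1 + eq_id)^11 = 1 + eq_id · Q`, degrees `50 + 5`);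
* `UnivNilp N` : over every commutative `ℂ`-algebra `T`, a `5 × 5` affine pencil with
  `det A(x) = λ · per₃(x)` has `λ ^ N = 0`; `pow_mem_of_univNilp : UnivNilp N → coef μ_id ^ N ∈ J`
  (apply it to `T = S ⧸ J`).

So `SmallCaseThreeFive` follows from `UnivNilp 11`, the line's remaining stub.
-/

noncomputable section
set_option linter.dupNamespace false

namespace Summit.ValiantsHypothesis.ValiantsHypothesis.Theorems.RefutationDegreeSmallCaseThreeFive

open Literature.Computability.AlgebraicComplexity MvPolynomial
open scoped BigOperators Matrix

/-- The index type of the `x`-variables: cells of a `3 × 3` matrix. -/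
abbrev E := Fin 3 × Fin 3

/-- The index type of the 250 unknowns: `(none, (i,j))` ↦ `(A₀)_{ij}`, `(some e, (i,j))` ↦ `(A_e)_{ij}`. -/
abbrev U := Option E × (Fin 5 × Fin 5)

/-- The coefficient ring `S = ℂ[A₀, A_e]` of the 250 unknowns. -/
abbrev S := MvPolynomial U ℂ

/-- The generic `5 × 5` affine pencil `A(x) = A₀ + Σ_e x_e A_e` over `S[x]`, literally as in the crux. -/
def pencil : Matrix (Fin 5) (Fin 5) (MvPolynomial E S) :=
  Matrix.of fun i j : Fin 5 => C (X (none, (i, j))) + ∑ e : E, X e * C (X (some e, (i, j)))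

/-- The defect `P = det A(x) - per₃(x)`, literally as in the crux. -/
def defect : MvPolynomial E S := pencil.det - map C (perPoly (Fin 3) ℂ)

/-- `coef μ` = the coefficient of `x^μ` in `det A(x)`: a quintic form in the unknowns. -/
def coef (μ : E →₀ ℕ) : S := pencil.det.coeff μ

/-- The exponent vector of the diagonal monomial `x₁₁ x₂₂ x₃₃`. -/
def idMon : E →₀ ℕ := permMonomial (Equiv.refl (Fin 3))

/-- The generators of the homogeneous ideal `J`: `coef μ` for non-permutation `μ`, and
`coef μ_ρ - coef μ_id` for permutations `ρ`. -/
def gens : Set S :=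
  {f | ∃ μ : E →₀ ℕ, μ ∉ Set.range (permMonomial (n := Fin 3)) ∧ f = coef μ} ∪
    {f | ∃ ρ : Equiv.Perm (Fin 3), f = coef (permMonomial ρ) - coef idMon}

/-- The homogeneous ideal `J ⊆ S` of the crux (its zero set is the cone of singular pencils together
with the — empty, by Alper–Bogart–Velasco — genuine representations). -/
def J : Ideal S := Ideal.span gens

/-- The crux, unfolded: literally the route decl with the `let`s named. -/
theorem smallCaseThreeFive_iff :
    Theses.RefutationDegree.SmallCaseThreeFive ↔
      ∃ h : (E →₀ ℕ) → S, (∀ μ, (h μ * defect.coeff μ).totalDegree ≤ 55) ∧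
        ∑ μ ∈ defect.support, h μ * defect.coeff μ = 1 :=
  Iff.rfl

end Summit.ValiantsHypothesis.ValiantsHypothesis.Theorems.RefutationDegreeSmallCaseThreeFive

namespace Summit.ValiantsHypothesis.ValiantsHypothesis.Theorems.RefutationDegreeSmallCaseThreeFive

open Literature.Computability.AlgebraicComplexity MvPolynomial
open scoped BigOperators Matrix

/-! ## Stubs of the transfer layer

All six transfer stubs (`stub_defect_coeff`, `stub_coef_isHomogeneous`, `stub_homogeneousComponent_mul`,
`stub_mapMatrix_pencil`, `stub_map_det_pencil`, `stub_binomial_eleven`) have LANDED under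
`Theorems/RefutationDegreeSmallCaseThreeFiveStub*.lean` (p107043, p107079, p107138, p107203, p107212,
p107421) and are imported above; the converse transfer `stub_univNilp_of_smallCaseThreeFive`
(crux → universal nilpotency, p108654) is imported too, so a single model with `λ ^ 11 ≠ 0` refutes
the crux (`not_smallCaseThreeFive_of_model` below). -/

/-! ## The algebraic heart: universal nilpotency -/

/-- STUB (the crux of the line): UNIVERSAL NILPOTENCY with exponent `11` — over every commutative
`ℂ`-algebra `T`, if a `5 × 5` affine pencil `A₀ + Σ_e x_e A_e` has determinant `λ · per₃(x)` in `T[x]`,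
then `λ ^ 11 = 0`. (For `T` a field this is `dc(per₃) > 5`, Alper–Bogart–Velasco; the exponent is the
content: the minimal NS degree of Rep(3,5) is `5 ·` the minimal such exponent.) -/
theorem stub_univNilp : ∀ (T : Type) [CommRing T] [Algebra ℂ T] (A₀ : Matrix (Fin 5) (Fin 5) T)
    (A : Fin 3 × Fin 3 → Matrix (Fin 5) (Fin 5) T) (l : T),
    (Matrix.of fun i j : Fin 5 => C (A₀ i j) + ∑ e : Fin 3 × Fin 3, X e * C (A e i j) :
        Matrix (Fin 5) (Fin 5) (MvPolynomial (Fin 3 × Fin 3) T)).det = C l * perPoly (Fin 3) T →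
      l ^ 11 = 0 := by
  sorry

/-! ## Compositions (real proofs modulo the stubs) -/

/-- The generators of `J` lie in `J`. -/
theorem coef_mem_J {μ : E →₀ ℕ} (hμ : μ ∉ Set.range (permMonomial (n := Fin 3))) : coef μ ∈ J :=
  Ideal.subset_span (Or.inl ⟨μ, hμ, rfl⟩)

/-- The differences `coef μ_ρ - coef μ_id` lie in `J`. -/
theorem sub_mem_J (ρ : Equiv.Perm (Fin 3)) : coef (permMonomial ρ) - coef idMon ∈ J :=
  Ideal.subset_span (Or.inr ⟨ρ, rfl⟩)

/-- Universal nilpotency with exponent `N` gives `coef μ_id ^ N ∈ J`: apply it to `T = S ⧸ J`. -/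
theorem pow_mem_of_univNilp {N : ℕ}
    (h : ∀ (T : Type) [CommRing T] [Algebra ℂ T] (A₀ : Matrix (Fin 5) (Fin 5) T)
      (A : E → Matrix (Fin 5) (Fin 5) T) (l : T),
      (Matrix.of fun i j : Fin 5 => C (A₀ i j) + ∑ e : E, X e * C (A e i j) :
          Matrix (Fin 5) (Fin 5) (MvPolynomial E T)).det = C l * perPoly (Fin 3) T →
        l ^ N = 0) :
    coef idMon ^ N ∈ J := by
  classical
  set f : S →+* S ⧸ J := Ideal.Quotient.mk J with hf
  have h0 : ∀ μ : E →₀ ℕ, μ ∉ Set.range (permMonomial (n := Fin 3)) → f (coef μ) = 0 := fun μ hμ =>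
    (Ideal.Quotient.eq_zero_iff_mem).2 (coef_mem_J hμ)
  have h1 : ∀ ρ : Equiv.Perm (Fin 3), f (coef (permMonomial ρ)) = f (coef idMon) := fun ρ => by
    rw [hf, Ideal.Quotient.eq]
    exact sub_mem_J ρ
  have hdet := stub_map_det_pencil f pencil.det h0 h1
  rw [RingHom.map_det] at hdet
  erw [stub_mapMatrix_pencil f] at hdet
  have hl := h (S ⧸ J) (fun i j => f (X (none, (i, j)))) (fun e i j => f (X (some e, (i, j))))
    (f (coef idMon)) hdet
  rw [← map_pow] at hl
  exact (Ideal.Quotient.eq_zero_iff_mem).1 hl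

/-! ## From `coef μ_id ^ 11 ∈ J` to the crux (homogeneous → inhomogeneous certificate) -/

/-- The indexed generating family of `J`: `gen μ = coef μ` off the permutation patterns and
`gen μ_ρ = coef μ_ρ - coef μ_id` on them (`gen μ_id = 0`). -/
def gen (μ : E →₀ ℕ) : S :=
  if μ ∈ Set.range (permMonomial (n := Fin 3)) then coef μ - coef idMon else coef μ

/-- `J` is contained in (in fact equal to) the span of the indexed family `gen`. -/
theorem J_le_span_range_gen : J ≤ Ideal.span (Set.range gen) := by
  refine Ideal.span_le.2 ?_
  rintro f (⟨μ, hμ, rfl⟩ | ⟨ρ, rfl⟩)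
  · refine Ideal.subset_span ⟨μ, ?_⟩
    simp [gen, hμ]
  · refine Ideal.subset_span ⟨permMonomial ρ, ?_⟩
    simp [gen]

/-- `μ_id` is a permutation pattern. -/
theorem idMon_mem_range : idMon ∈ Set.range (permMonomial (n := Fin 3)) := ⟨_, rfl⟩

/-- `coef μ` is a quintic form (the stub, specialised). -/
theorem coef_isHomogeneous (μ : E →₀ ℕ) : (coef μ).IsHomogeneous 5 :=
  stub_coef_isHomogeneous μ

/-- The defect coefficients (the stub, specialised). -/
theorem defect_coeff (μ : E →₀ ℕ) :
    defect.coeff μ = coef μ - if μ ∈ Set.range (permMonomial (n := Fin 3)) then 1 else 0 :=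
  stub_defect_coeff pencil.det μ

/-- Every `gen μ` is a quintic form. -/
theorem gen_isHomogeneous (μ : E →₀ ℕ) : (gen μ).IsHomogeneous 5 := by
  unfold gen
  split_ifs
  · exact (coef_isHomogeneous μ).sub (coef_isHomogeneous idMon)
  · exact coef_isHomogeneous μ

/-- `gen μ` in terms of the defect coefficients `eq_μ = P.coeff μ`:
`gen μ = eq_μ - [μ permutation] · eq_id`. -/
theorem gen_eq (μ : E →₀ ℕ) :
    gen μ = defect.coeff μ -
      if μ ∈ Set.range (permMonomial (n := Fin 3)) then defect.coeff idMon else 0 := by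
  rw [defect_coeff μ, defect_coeff idMon, if_pos idMon_mem_range]
  unfold gen
  split_ifs <;> ring

/-- The defect coefficients have degree `≤ 5`. -/
theorem totalDegree_defect_coeff_le (μ : E →₀ ℕ) : (defect.coeff μ).totalDegree ≤ 5 := by
  rw [defect_coeff]
  split_ifs
  · rw [← C_1]
    exact (totalDegree_sub_C_le _ _).trans (coef_isHomogeneous μ).totalDegree_le
  · rw [sub_zero]
    exact (coef_isHomogeneous μ).totalDegree_le

/-- **Transfer.** `coef μ_id ^ 11 ∈ J → SmallCaseThreeFive`: project a witnessing combination to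
degree `55` (all generators are quintic forms), rewrite `coef μ_ρ - coef μ_id = eq_ρ - eq_id` and
`coef μ_id ^ 11 = (1 + eq_id)^11 = 1 + eq_id · Q`, and read off multipliers of degree `≤ 50`. -/
theorem smallCaseThreeFive_of_pow_mem (hmem : coef idMon ^ 11 ∈ J) :
    Theses.RefutationDegree.SmallCaseThreeFive := by
  classical
  rw [smallCaseThreeFive_iff]
  obtain ⟨c, hc⟩ := (Finsupp.mem_span_range_iff_exists_finsupp).1 (J_le_span_range_gen hmem)
  set s : Finset (E →₀ ℕ) := c.support with hs
  set c' : (E →₀ ℕ) → S := fun μ => homogeneousComponent 50 (c μ) with hc'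
  set eq : (E →₀ ℕ) → S := fun μ => defect.coeff μ with heq
  -- project the combination to degree 55
  have hsum : ∑ μ ∈ s, c' μ * gen μ = coef idMon ^ 11 := by
    have h55 : homogeneousComponent 55 (coef idMon ^ 11) = coef idMon ^ 11 :=
      homogeneousComponent_eq_self ((coef_isHomogeneous idMon).pow 11)
    rw [← h55, ← hc, Finsupp.sum, map_sum]
    refine Finset.sum_congr rfl fun μ _ => ?_
    rw [smul_eq_mul, show (55 : ℕ) = 50 + 5 from rfl,
      stub_homogeneousComponent_mul _ _ (gen_isHomogeneous μ)]
  set B : S := ∑ μ ∈ s.filter (· ∈ Set.range (permMonomial (n := Fin 3))), c' μ with hB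
  obtain ⟨Q, hQ, hQdeg⟩ := stub_binomial_eleven (eq idMon)
  -- the inhomogeneous identity
  have hone : ∑ μ ∈ s, c' μ * eq μ - (B + Q) * eq idMon = 1 := by
    have h1 : ∑ μ ∈ s, c' μ * gen μ = ∑ μ ∈ s, c' μ * eq μ - B * eq idMon := by
      simp only [gen_eq, mul_sub, Finset.sum_sub_distrib, hB, Finset.sum_mul, Finset.sum_filter,
        mul_ite, mul_zero, ite_mul, zero_mul, heq]
    have h2 : coef idMon ^ 11 = 1 + eq idMon * Q := by
      have : coef idMon = eq idMon + 1 := by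
        simp only [heq, defect_coeff, if_pos idMon_mem_range, sub_add_cancel]
      rw [this]
      exact hQ
    rw [h1, h2] at hsum
    linear_combination hsum
  -- the multipliers
  refine ⟨fun μ => c' μ - if μ = idMon then B + Q else 0, ?_, ?_⟩
  · -- degrees
    intro μ
    show ((c' μ - if μ = idMon then B + Q else 0) * defect.coeff μ).totalDegree ≤ 55
    refine (totalDegree_mul _ _).trans ?_
    have hc'deg : (c' μ).totalDegree ≤ 50 := (homogeneousComponent_isHomogeneous 50 (c μ)).totalDegree_le
    have hite : (if μ = idMon then B + Q else 0).totalDegree ≤ 50 := by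
      split_ifs
      · refine (totalDegree_add _ _).trans (max_le ?_ ?_)
        · exact totalDegree_finsetSum_le fun ν _ =>
            (homogeneousComponent_isHomogeneous 50 (c ν)).totalDegree_le
        · exact hQdeg.trans (by
            have := totalDegree_defect_coeff_le idMon
            simp only [heq]
            omega)
      · simp
    have hsub := (totalDegree_sub (c' μ) (if μ = idMon then B + Q else 0)).trans
      (max_le hc'deg hite)
    have := totalDegree_defect_coeff_le μ
    omega
  · -- the sum
    have key : ∀ t : Finset (E →₀ ℕ), s ⊆ t → idMon ∈ t →
        ∑ μ ∈ t, (c' μ - if μ = idMon then B + Q else 0) * defect.coeff μ = 1 := by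
      intro t hst hid
      have hc'0 : ∀ μ, μ ∉ s → c' μ = 0 := fun μ hμ => by
        simp only [hc', hs] at hμ ⊢
        rw [Finsupp.notMem_support_iff.1 hμ, map_zero]
      simp only [sub_mul, Finset.sum_sub_distrib, ite_mul, zero_mul, Finset.sum_ite_eq', if_pos hid]
      rw [← Finset.sum_subset hst (fun μ _ hμ => by rw [hc'0 μ hμ, zero_mul])]
      exact hone
    have hsub1 : s ⊆ defect.support ∪ (insert idMon s) :=
      (Finset.subset_insert _ _).trans Finset.subset_union_right
    rw [← key (defect.support ∪ insert idMon s) hsub1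
      (Finset.mem_union_right _ (Finset.mem_insert_self _ _))]
    refine Finset.sum_subset Finset.subset_union_left fun μ _ hμ => ?_
    rw [MvPolynomial.notMem_support_iff.1 hμ, mul_zero]

/-- **The line, assembled:** `SmallCaseThreeFive` from the universal nilpotency stub. -/
theorem SmallCaseThreeFive_of :
    Theses.RefutationDegree.SmallCaseThreeFive :=
  smallCaseThreeFive_of_pow_mem (pow_mem_of_univNilp stub_univNilp)

/-- **Refutation branch.** A single model — a commutative `ℂ`-algebra `T`, a `5 × 5` affine pencil
over `T` with `det = λ · per₃`, and `λ ^ 11 ≠ 0` — refutes the crux (contrapositive of the landed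
converse transfer `stub_univNilp_of_smallCaseThreeFive`). -/
theorem not_smallCaseThreeFive_of_model (T : Type) [CommRing T] [Algebra ℂ T]
    (A₀ : Matrix (Fin 5) (Fin 5) T) (A : Fin 3 × Fin 3 → Matrix (Fin 5) (Fin 5) T) (l : T)
    (hdet : (Matrix.of fun i j : Fin 5 => C (A₀ i j) + ∑ e : Fin 3 × Fin 3, X e * C (A e i j) :
        Matrix (Fin 5) (Fin 5) (MvPolynomial (Fin 3 × Fin 3) T)).det = C l * perPoly (Fin 3) T)
    (hl : l ^ 11 ≠ 0) : ¬ Theses.RefutationDegree.SmallCaseThreeFive := fun h =>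
  hl (stub_univNilp_of_smallCaseThreeFive h T A₀ A l hdet)

end Summit.ValiantsHypothesis.ValiantsHypothesis.Theorems.RefutationDegreeSmallCaseThreeFive
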